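import Summits.Ventures.CertifiedArithmetic.LowPrec.GemmDeficit

/-!
# The terminal constant `θ` bounds the defect `1 - W(n)` for every `n` — reduced to the two graph facts

HONEST FRAMING (venture CertifiedArithmetic / cell `pub-lowprec`, seat gemm, gen 5): certified error
envelopes and provably optimal rounding/accumulation schemes for low-precision formats under stated
cost models; every table by two implementations; no hardware or vendor claims.

Paper `gemm.tex` §Regimes, Prop. "the terminal constant bounds the defect for every n" (i), in the
cell's sequential model `seqSum` (round-to-nearest-even into the format `α`, first term rounded, no
range hypothesis needed because `roundNE` is nearest-value rounding into the finite values).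
Read an input `x 0, x 1, …, x m` (`n = m + 1` terms) as a walk of the accumulator; step `j ≥ 1` has
GAIN `δ j = ŝ_j - (ŝ_{j-1} + x j)` (`stepGain`) and DEFICIT `d j = |x j| - δ j ≥ 0` (`stepDeficit`,
`stepDeficit_nonneg` — the deficit lemma of `GemmDeficit.lean`); `G = Σ δ = ŝ_m - Σ x`
(`sum_stepGain`), `D = Σ d`, and the mass is `L = Σ |x j| = G + D` (`sum_abs_eq_gain_add_deficit`).
The paper's argument: delete the absorbed letters (set `A` of step indices); the remaining MOVING
steps satisfy `Σ δ ≤ β̄ · Σ d` (Lemma "moving walks", a finite maximum `β̄` over the reachable graph,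
computed by two implementations), and an absorption at step `j` gains at most the capacity of its
vertex, which is at most `Φ(vertex)/θ ≤ D_{<j}/θ` by the definition of `θ = min Φ/c` and of the
potential `Φ` (again graph constants by two implementations).  THIS FILE kernel-checks everything
else: given those two facts as hypotheses `hM`, `hC` about the walk — in whatever way the index set
`A ⊆ {1,…,m}` is chosen — the relative defect obeys
`θ / (m + θ(1 + β̄)) ≤ 1 - (ŝ_m - Σ x) / Σ|x|` (`theta_defect_bound`), i.e. with `n = m + 1` terms
`1 - W(n) ≥ θ/(n - 1 + θ(1 + β̄))`.  The bookkeeping is `mul_sum_gain_le` (split the steps into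
`A` and the rest; `|A| ≤ m`) and the algebra is `theta_div_le_one_sub_ratio`.  The closed forms of
the certified instances are checked at the end (`…_const`): E2M1²→bfloat16 `210/(8n+2625)`,
E2M1²→binary16 `1666/(8n+20825)`, E2M3²→bfloat16 `1746/(679n+168386)`, E3M2²→bfloat16
`12490/(1024n+206085)` (constants `θ`, `β̄` from `certs/gemm/regimes/theta_*_{a,b}.json`, two
implementations, byte-identical certificate blocks; NOT kernel-checked).
-/

namespace Literature.ComputerArithmetic.FloatingPoint

namespace MiniFloat

open Finset

variable {α : Format}

/-- GAIN of step `j` of the sequential accumulation of `x`: `δ j = ŝ_j - (ŝ_{j-1} + x j)` for `j ≥ 1`,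
and `δ 0 = ŝ_0 - x 0` (zero for a representable first term). [cell definition, gemm.tex §Regimes] -/
def stepGain (α : Format) (x : ℕ → ℚ) : ℕ → ℚ
  | 0 => (seqSum α x 0).toRat - x 0
  | j + 1 => (seqSum α x (j + 1)).toRat - ((seqSum α x j).toRat + x (j + 1))

/-- DEFICIT of step `j`: `d j = |x j| - δ j`. [cell definition, gemm.tex §Regimes] -/
def stepDeficit (α : Format) (x : ℕ → ℚ) (j : ℕ) : ℚ := |x j| - stepGain α x j

/-- A representable first term is loaded exactly: `δ 0 = 0`. [folklore] -/
theorem stepGain_zero_of_exists (x : ℕ → ℚ) (h0 : ∃ y : MiniFloat α, y.toRat = x 0) :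
    stepGain α x 0 = 0 := by
  simp [stepGain, seqSum, toRat_roundNE_of_exists h0]

/-- The deficit lemma, per step: `δ (j+1) ≤ |x (j+1)|`. [folklore; GemmDeficit.gain_step_le_abs] -/
theorem stepGain_succ_le (x : ℕ → ℚ) (j : ℕ) : stepGain α x (j + 1) ≤ |x (j + 1)| :=
  gain_step_le_abs (seqSum α x j) (x (j + 1))

/-- Every deficit is nonnegative (first term representable). [folklore] -/
theorem stepDeficit_nonneg (x : ℕ → ℚ) (h0 : ∃ y : MiniFloat α, y.toRat = x 0) :
    ∀ j, 0 ≤ stepDeficit α x j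
  | 0 => by
      rw [stepDeficit, stepGain_zero_of_exists x h0, sub_zero]
      exact abs_nonneg _
  | j + 1 => sub_nonneg.mpr (stepGain_succ_le x j)

/-- Telescoping: `Σ_{j ≤ m} δ j = ŝ_m - Σ_{j ≤ m} x j` (the signed error is the total gain). [folklore] -/
theorem sum_stepGain (x : ℕ → ℚ) :
    ∀ m, ∑ j ∈ range (m + 1), stepGain α x j = (seqSum α x m).toRat - ∑ j ∈ range (m + 1), x j
  | 0 => by simp [stepGain]
  | m + 1 => by
      rw [sum_range_succ, sum_stepGain x m, sum_range_succ (fun j => x j) (m + 1)]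
      simp only [stepGain]
      ring

/-- Mass = gain + deficit: `Σ_{j ≤ m} |x j| = (ŝ_m - Σ x) + Σ_{j ≤ m} d j`. [folklore] -/
theorem sum_abs_eq_gain_add_deficit (x : ℕ → ℚ) (m : ℕ) :
    ∑ j ∈ range (m + 1), |x j|
      = ((seqSum α x m).toRat - ∑ j ∈ range (m + 1), x j) + ∑ j ∈ range (m + 1), stepDeficit α x j := by
  have h := sum_stepGain (α := α) x m
  simp only [stepDeficit, sum_sub_distrib] at *
  rw [h]
  ring

/-- BOOKKEEPING of the proof of Prop. Θ(i): split the steps `0..m` into a set `A` ("absorptions")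
and the rest ("moves").  If the moves satisfy `Σ δ ≤ β Σ d` and every `j ∈ A` satisfies
`θ δ j ≤ Σ_{i<j} d i`, then `θ Σ δ ≤ (θ β + |A|) Σ d` (all deficits nonnegative). [cell, gemm.tex Prop. Θ] -/
theorem mul_sum_gain_le {δ d : ℕ → ℚ} {m : ℕ} {A : Finset ℕ} {θ β : ℚ}
    (hθ : 0 ≤ θ) (hβ : 0 ≤ β) (hA : A ⊆ range (m + 1)) (hd : ∀ j ∈ range (m + 1), 0 ≤ d j)
    (hM : ∑ j ∈ range (m + 1) \ A, δ j ≤ β * ∑ j ∈ range (m + 1) \ A, d j)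
    (hC : ∀ j ∈ A, θ * δ j ≤ ∑ i ∈ range j, d i) :
    θ * ∑ j ∈ range (m + 1), δ j ≤ (θ * β + A.card) * ∑ j ∈ range (m + 1), d j := by
  have hsplit : ∑ j ∈ range (m + 1), δ j = ∑ j ∈ range (m + 1) \ A, δ j + ∑ j ∈ A, δ j :=
    (sum_sdiff hA).symm
  have h1 : ∑ j ∈ range (m + 1) \ A, d j ≤ ∑ j ∈ range (m + 1), d j :=
    sum_le_sum_of_subset_of_nonneg sdiff_subset fun j hj _ => hd j hj
  have h2 : ∀ j ∈ A, θ * δ j ≤ ∑ i ∈ range (m + 1), d i := fun j hj =>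
    le_trans (hC j hj)
      (sum_le_sum_of_subset_of_nonneg
        (fun i hi => mem_range.mpr (lt_of_lt_of_le (mem_range.mp hi) (mem_range.mp (hA hj)).le))
        fun i hi _ => hd i hi)
  have h3 : θ * ∑ j ∈ A, δ j ≤ A.card * ∑ i ∈ range (m + 1), d i := by
    rw [mul_sum]
    calc ∑ j ∈ A, θ * δ j ≤ ∑ j ∈ A, ∑ i ∈ range (m + 1), d i := sum_le_sum h2
      _ = A.card * ∑ i ∈ range (m + 1), d i := by rw [sum_const, nsmul_eq_mul]
  have h4 : θ * ∑ j ∈ range (m + 1) \ A, δ j ≤ θ * β * ∑ j ∈ range (m + 1), d j :=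
    calc θ * ∑ j ∈ range (m + 1) \ A, δ j ≤ θ * (β * ∑ j ∈ range (m + 1) \ A, d j) :=
          mul_le_mul_of_nonneg_left hM hθ
      _ ≤ θ * (β * ∑ j ∈ range (m + 1), d j) :=
          mul_le_mul_of_nonneg_left (mul_le_mul_of_nonneg_left h1 hβ) hθ
      _ = θ * β * ∑ j ∈ range (m + 1), d j := by ring
  rw [hsplit, mul_add, add_mul]
  linarith

/-- ALGEBRA of the proof of Prop. Θ(i): if `L = G + D > 0`, `D ≥ 0`, `θ G ≤ (θ β + a) D` with
`a ≤ m`, then `θ/(m + θ(1+β)) ≤ 1 - G/L` (with `K = β + m/θ`: `G ≤ K D` gives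
`G/(G+D) ≤ K/(K+1)`). [cell, gemm.tex Prop. Θ] -/
theorem theta_div_le_one_sub_ratio {θ β G D L : ℚ} {a m : ℕ} (hθ : 0 < θ) (hβ : 0 ≤ β)
    (hD : 0 ≤ D) (hL : 0 < L) (hLD : L = G + D) (hG : θ * G ≤ (θ * β + a) * D) (ha : a ≤ m) :
    θ / (m + θ * (1 + β)) ≤ 1 - G / L := by
  have hden : 0 < (m : ℚ) + θ * (1 + β) := by positivity
  have ham : (a : ℚ) ≤ m := by exact_mod_cast ha
  have hG' : θ * G ≤ (θ * β + m) * D :=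
    le_trans hG (mul_le_mul_of_nonneg_right (by linarith) hD)
  have hone : 1 - G / L = D / L := by
    rw [hLD]
    have hL0 : G + D ≠ 0 := by rw [← hLD]; exact hL.ne'
    field_simp
    ring
  rw [hone, ← sub_nonneg, div_sub_div _ _ hL.ne' hden.ne']
  apply div_nonneg _ (by positivity)
  rw [hLD]
  nlinarith

/-- PROP. Θ(i) OF THE PAPER, REDUCED TO THE TWO GRAPH FACTS.  Sequential round-to-nearest-even
accumulation `ŝ` of `x 0, …, x m` into `α` with `x 0` representable; `A ⊆ {1, …, m}` any set of step
indices (in the paper: the absorptions, `ŝ_j = ŝ_{j-1}`); hypotheses: the steps outside `A` satisfy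
`Σ δ ≤ β Σ d` (`hM`: Lemma "moving walks" with the graph constant `β̄`), and every `j ∈ A` has
`θ δ j ≤ Σ_{i<j} d i` (`hC`: capacity `≤ Φ/θ ≤ D_{<j}/θ`; trivially true for lossy and null
absorptions, whose gain is `≤ 0`).  Conclusion: the relative signed error is at most
`1 - θ/(m + θ(1+β))`, i.e. `1 - W(n) ≥ θ/(n - 1 + θ(1 + β̄))` for `n = m + 1` terms.
(The absolute-value form follows by applying the statement to `-x`, whose walk is the mirror image.)
[cell, gemm.tex §Regimes Prop. Θ(i); the constants θ, β̄ are two-implementation certificates] -/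
theorem theta_defect_bound (x : ℕ → ℚ) (h0 : ∃ y : MiniFloat α, y.toRat = x 0) (m : ℕ)
    (A : Finset ℕ) (hA : A ⊆ Ico 1 (m + 1)) {θ β : ℚ} (hθ : 0 < θ) (hβ : 0 ≤ β)
    (hM : ∑ j ∈ range (m + 1) \ A, stepGain α x j ≤ β * ∑ j ∈ range (m + 1) \ A, stepDeficit α x j)
    (hC : ∀ j ∈ A, θ * stepGain α x j ≤ ∑ i ∈ range j, stepDeficit α x i)
    (hL : 0 < ∑ j ∈ range (m + 1), |x j|) :
    θ / (m + θ * (1 + β))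
      ≤ 1 - ((seqSum α x m).toRat - ∑ j ∈ range (m + 1), x j) / ∑ j ∈ range (m + 1), |x j| := by
  have hA' : A ⊆ range (m + 1) := fun j hj => by
    have := mem_Ico.mp (hA hj); exact mem_range.mpr this.2
  have hd : ∀ j ∈ range (m + 1), 0 ≤ stepDeficit α x j := fun j _ => stepDeficit_nonneg x h0 j
  have hkey := mul_sum_gain_le hθ.le hβ hA' hd hM hC
  rw [sum_stepGain] at hkey
  have hcard : A.card ≤ m := by
    have := card_le_card hA
    simpa using this
  exact theta_div_le_one_sub_ratio hθ hβ (sum_nonneg hd) hL (sum_abs_eq_gain_add_deficit x m) hkey hcard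

/-- The same bound read as an upper bound on the relative signed error. [cell, gemm.tex Prop. Θ(i)] -/
theorem ratio_le_one_sub_theta_div (x : ℕ → ℚ) (h0 : ∃ y : MiniFloat α, y.toRat = x 0) (m : ℕ)
    (A : Finset ℕ) (hA : A ⊆ Ico 1 (m + 1)) {θ β : ℚ} (hθ : 0 < θ) (hβ : 0 ≤ β)
    (hM : ∑ j ∈ range (m + 1) \ A, stepGain α x j ≤ β * ∑ j ∈ range (m + 1) \ A, stepDeficit α x j)
    (hC : ∀ j ∈ A, θ * stepGain α x j ≤ ∑ i ∈ range j, stepDeficit α x i)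
    (hL : 0 < ∑ j ∈ range (m + 1), |x j|) :
    ((seqSum α x m).toRat - ∑ j ∈ range (m + 1), x j) / ∑ j ∈ range (m + 1), |x j|
      ≤ 1 - θ / (m + θ * (1 + β)) := by
  have := theta_defect_bound x h0 m A hA hθ hβ hM hC hL
  linarith

/-! ### The certified instances: closed forms of `θ/(n - 1 + θ(1 + β̄))` (constants from the
two-implementation certificates `certs/gemm/regimes/theta_*`; here only the arithmetic is checked) -/

/-- E2M1²→bfloat16: `θ = 105/4`, `β̄ = 2423/210`; with `n = m + 1`: `θ/(m + θ(1+β̄)) = 210/(8n + 2625)`.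
[cell certificate theta_e2m1_e2m1_bfloat16_exact_RNE_{a,b}.json] -/
theorem theta_bound_E2M1_BFloat16_const (m : ℕ) :
    (105 / 4 : ℚ) / (m + 105 / 4 * (1 + 2423 / 210)) = 210 / (8 * (m + 1) + 2625) := by
  rw [div_eq_div_iff (by positivity) (by positivity)]
  ring

/-- E2M1²→binary16: `θ = 833/4`, `β̄ = 19167/1666`; `θ/(m + θ(1+β̄)) = 1666/(8n + 20825)`, `n = m + 1`.
[cell certificate theta_e2m1_e2m1_binary16_exact_RNE_{a,b}.json] -/
theorem theta_bound_E2M1_Binary16_const (m : ℕ) :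
    (833 / 4 : ℚ) / (m + 833 / 4 * (1 + 19167 / 1666)) = 1666 / (8 * (m + 1) + 20825) := by
  rw [div_eq_div_iff (by positivity) (by positivity)]
  ring

/-- E2M3²→bfloat16: `θ = 18/7`, `β̄ = 18591/194`; `θ/(m + θ(1+β̄)) = 1746/(679n + 168386)`, `n = m + 1`.
[cell certificate theta_e2m3_e2m3_bfloat16_exact_RNE_{a,b}.json] -/
theorem theta_bound_E2M3_BFloat16_const (m : ℕ) :
    (18 / 7 : ℚ) / (m + 18 / 7 * (1 + 18591 / 194)) = 1746 / (679 * (m + 1) + 168386) := by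
  rw [div_eq_div_iff (by positivity) (by positivity)]
  ring

/-- E3M2²→bfloat16: `θ = 6245/512`, `β̄ = 194619/12490`; `θ/(m + θ(1+β̄)) = 12490/(1024n + 206085)`,
`n = m + 1` (the first statement valid for every `n` for this configuration).
[cell certificate theta_e3m2_e3m2_bfloat16_exact_RNE_{a,b}.json] -/
theorem theta_bound_E3M2_BFloat16_const (m : ℕ) :
    (6245 / 512 : ℚ) / (m + 6245 / 512 * (1 + 194619 / 12490)) = 12490 / (1024 * (m + 1) + 206085) := by
  rw [div_eq_div_iff (by positivity) (by positivity)]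
  ring

end MiniFloat

end Literature.ComputerArithmetic.FloatingPoint
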